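import Summits.AtomisticToContinuum.HydrodynamicLimit.Theses.InformationPercolationEngine
import Summits.AtomisticToContinuum.HydrodynamicLimit.Theorems.InformationPercolationEngineChaosClosesEulerCollisionInvariance
import Literature.Analysis.FluidPDE.EmpiricalCollisionMeasure
import HarnessLib

/-!
# Windowed collision invariance of the normalised collision functional (crux `ChaosClosesEuler`,
stmt-AtomisticToContinuum-15141, line `Sketch`, stub `stub_windowedCollisionInvariance`)

WHAT. The registered stub `stub_windowedCollisionInvariance` of the line `Sketch` on the crux
`InformationPercolationEngine.ChaosClosesEuler`: along ONE good orbit of the hard-sphere flow on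
`𝕋³` at fixed reduced density (`ε = hsDiameter σ N`), for every window centre `(t₀, x₀)`, radius
`r > 0` and bounded `ψ` (`|ψ| ≤ Cψ`), the tent-in-time × cone-in-space windowed, normalised
collision functional of the jump `ψ(vᵢ⁺) − ψ(vᵢ⁻)` — written as an integral against the
(unnormalised) empirical collision measure of the orbit over the time window `[0, τ]`, whose marks
are `m = (t, xᵢ, n̂, vᵢ⁻, vⱼ⁻)` with `n̂ = ε⁻¹ (xᵢ − xⱼ)` and `vᵢ⁺ = (reflectVel n̂ (vᵢ⁻, vⱼ⁻)).1` —
is `O(ε)`: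
`|ε/(N+1) ∫ bt(t − t₀) bx(xᵢ, x₀) (ψ(vᵢ⁺) − ψ(vᵢ⁻)) dκ| ≤ ε Cψ (6/(π r⁴) + 3/(π r⁵) τ (3/2 + E/(N+1)))`,
`bt a = r⁻¹ max(1 − |a|/r, 0)`, `bx(x, y) = 3/(π r³) max(1 − d(x, y)/r, 0)`, `E` the kinetic energy.

PROOF. `HardSphereFlow.integral_empiricalCollisionMeasure_eq_finsum_ite` unfolds the integral to
the inline ordered-contact-pair collision sum; at a contact term the recorded pre-collisional pair
is `reflectVel n (vᵢ, vⱼ)` with `n = xᵢ − xⱼ`, `‖n‖ = ε > 0`, and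
`reflectVel (ε⁻¹ n) (reflectVel n (vᵢ, vⱼ)) = (vᵢ, vⱼ)` (`reflectVel_smul`, `reflectVel_reflectVel`),
so the integrand is `χ(s, xᵢ)(ψ(vᵢ) − ψ(vᵢ⁻))` with the weight `χ(s, x) = bt(s − t₀) bx(x, x₀)`,
which is bounded by `3/(π r⁴)` and `3/(π r⁵)`-Lipschitz in `|s − s'| + d(x, x')` (the tent
`max(1 − |a|/r, 0)` is `r⁻¹`-Lipschitz, `abs_max_sub_max_le_abs`, `abs_abs_sub_abs_le`; the cone is
`r⁻¹`-Lipschitz in the minimal-image distance, `Torus.euclidDist_triangle`). The landed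
deterministic Abel-summation bound
`ChaosClosesEulerCollisionInvariance.collisionInvariance_of_trajectory` (p98069) with
`Cχ = 3/(π r⁴)`, `Lχ = 3/(π r⁵)` gives the claim (`2 Cχ = 6/(π r⁴)`).

REFERENCES. N. N. Bogolyubov, *Microscopic solutions of the Boltzmann–Enskog equation in kinetic
theory for elastic balls*, Theor. Math. Phys. 24 (1975) 804–807; M. Pulvirenti, S. Simonella,
*On the evolution of the empirical measure for the hard-sphere dynamics*, arXiv:1504.03215, §3
Thm 1 (exact weak equation for the empirical measure of one hard-sphere trajectory).
-/

noncomputable section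

namespace Summit.AtomisticToContinuum.HydrodynamicLimit.Theorems.ChaosClosesEulerWindowedInvariance

open scoped BigOperators Topology Classical MeasureTheory ENNReal InnerProductSpace
open Filter Set MeasureTheory
open Literature.MathematicalPhysics.KineticTheory
open Literature.Analysis.FluidPDE
open Summit.AtomisticToContinuum.HydrodynamicLimit.Theorems.ChaosClosesEulerCollisionInvariance

/-! ## §1 The tent and the cone: range and Lipschitz bounds -/

/-- The truncated profile `max (1 − u, 0)` lies in `[0, 1]` for `u ≥ 0`. [folklore] -/
theorem max_one_sub_mem {u : ℝ} (hu : 0 ≤ u) : 0 ≤ max (1 - u) 0 ∧ max (1 - u) 0 ≤ 1 :=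
  ⟨le_max_right _ _, max_le (by linarith) zero_le_one⟩

/-- The truncated profile `u ↦ max (1 − u/r, 0)` is `r⁻¹`-Lipschitz (`r > 0`). [folklore] -/
theorem abs_max_sub_max_div_le {r : ℝ} (hr : 0 < r) (u u' : ℝ) :
    |max (1 - u / r) 0 - max (1 - u' / r) 0| ≤ |u - u'| / r := by
  refine (abs_max_sub_max_le_abs _ _ _).trans ?_
  rw [show (1 - u / r) - (1 - u' / r) = (u' - u) / r by ring, abs_div, abs_of_pos hr, abs_sub_comm]

/-- The time tent `bt a = r⁻¹ max (1 − |a|/r, 0)` satisfies `0 ≤ bt a ≤ r⁻¹`. [folklore] -/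
theorem tent_nonneg_le {r : ℝ} (hr : 0 < r) (a : ℝ) :
    0 ≤ r⁻¹ * max (1 - |a| / r) 0 ∧ r⁻¹ * max (1 - |a| / r) 0 ≤ r⁻¹ := by
  have h := max_one_sub_mem (div_nonneg (abs_nonneg a) hr.le)
  have hr' : 0 ≤ r⁻¹ := inv_nonneg.2 hr.le
  exact ⟨mul_nonneg hr' h.1, by nlinarith [h.2]⟩

/-- The time tent is `r⁻²`-Lipschitz: `|bt a − bt a'| ≤ r⁻¹ (|a − a'| / r)`. [folklore] -/
theorem abs_tent_sub_tent_le {r : ℝ} (hr : 0 < r) (a a' : ℝ) :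
    |r⁻¹ * max (1 - |a| / r) 0 - r⁻¹ * max (1 - |a'| / r) 0| ≤ r⁻¹ * (|a - a'| / r) := by
  rw [← mul_sub, abs_mul, abs_of_pos (inv_pos.2 hr)]
  refine mul_le_mul_of_nonneg_left ((abs_max_sub_max_div_le hr _ _).trans ?_) (inv_pos.2 hr).le
  exact div_le_div_of_nonneg_right (abs_abs_sub_abs_le a a') hr.le

/-- The space cone `bx x y = 3/(π r³) max (1 − d(x, y)/r, 0)` satisfies `0 ≤ bx ≤ 3/(π r³)`.
[folklore] -/
theorem cone_nonneg_le {r : ℝ} (hr : 0 < r) (x y : T3) :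
    0 ≤ 3 / (Real.pi * r ^ 3) * max (1 - Torus.euclidDist x y / r) 0 ∧
      3 / (Real.pi * r ^ 3) * max (1 - Torus.euclidDist x y / r) 0 ≤ 3 / (Real.pi * r ^ 3) := by
  have hM : 0 ≤ 3 / (Real.pi * r ^ 3) := by positivity
  have hd : 0 ≤ Torus.euclidDist x y := norm_nonneg _
  have h := max_one_sub_mem (div_nonneg hd hr.le)
  exact ⟨mul_nonneg hM h.1, by nlinarith [h.2]⟩

/-- The space cone is Lipschitz in the particle position for the minimal-image distance:
`|bx(x, y) − bx(x', y)| ≤ 3/(π r³) (d(x, x') / r)`. [folklore] -/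
theorem abs_cone_sub_cone_le {r : ℝ} (hr : 0 < r) (x x' y : T3) :
    |3 / (Real.pi * r ^ 3) * max (1 - Torus.euclidDist x y / r) 0 -
        3 / (Real.pi * r ^ 3) * max (1 - Torus.euclidDist x' y / r) 0| ≤
      3 / (Real.pi * r ^ 3) * (Torus.euclidDist x x' / r) := by
  have hM : 0 ≤ 3 / (Real.pi * r ^ 3) := by positivity
  rw [← mul_sub, abs_mul, abs_of_nonneg hM]
  refine mul_le_mul_of_nonneg_left ((abs_max_sub_max_div_le hr _ _).trans ?_) hM
  refine div_le_div_of_nonneg_right (abs_sub_le_iff.2 ⟨?_, ?_⟩) hr.le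
  · have h := Torus.euclidDist_triangle x x' y
    linarith
  · have h := Torus.euclidDist_triangle x' x y
    rw [Torus.euclidDist_comm x' x] at h
    linarith

/-! ## §2 The recorded marks: post-collisional velocity from the pre-collisional pair -/

/-- At a contact term of the collision sum (`‖n‖ = ε > 0`, `n = xᵢ − xⱼ`), reflecting the recorded
pre-collisional pair `reflectVel n (vᵢ, vⱼ)` in the recorded unit direction `ε⁻¹ n` returns the
post-collisional velocity `vᵢ` (`reflectVel_smul`, `reflectVel_reflectVel`). [folklore] -/
theorem reflectVel_unit_pre_fst {ε : ℝ} (hε : 0 < ε) (n : V3) (p : V3 × V3) :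
    (reflectVel (ε⁻¹ • n) ((reflectVel n p).1, (reflectVel n p).2)).1 = p.1 := by
  rw [Prod.mk.eta, reflectVel_smul (inv_ne_zero hε.ne'), reflectVel_reflectVel]

/-! ## §3 The registered stub -/

/-- **STUB `stub_windowedCollisionInvariance` (line `Sketch`, crux `ChaosClosesEuler`, stmt-15141):
windowed collision invariance in the empirical-collision-measure vocabulary.** For every window
centre `(t₀, x₀)`, radius `r > 0` and bounded `ψ`, the tent × cone windowed, normalised collision
functional of the jump `ψ(vᵢ⁺) − ψ(vᵢ⁻)` against the empirical collision measure of a good orbit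
over `[0, τ]` is at most `ε Cψ (6/(π r⁴) + 3/(π r⁵) τ (3/2 + E/(N+1)))`: the landed pathwise
Abel-summation bound `collisionInvariance_of_trajectory` with the weight
`χ(s, x) = bt(s − t₀) bx(x, x₀)` (`sup ≤ 3/(π r⁴)`, `Lip ≤ 3/(π r⁵)`), after unfolding the integral
(`HardSphereFlow.integral_empiricalCollisionMeasure_eq_finsum_ite`) and undoing the recorded
reflection (`reflectVel_unit_pre_fst`). [folklore] -/
theorem stub_windowedCollisionInvariance :
    ∀ (σ : ℝ), 0 < σ → σ < 2⁻¹ → ∀ (N : ℕ)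
    (Φ : HardSphereFlow (Torus.geometry (Fin 3)) (hsDiameter σ N) (N + 1)),
    ∀ z ∈ Φ.good, ∀ τ : ℝ, 0 < τ → ∀ r : ℝ, 0 < r → ∀ (t₀ : ℝ) (x₀ : T3),
    ∀ (ψ : V3 → ℝ) (Cψ : ℝ), 0 ≤ Cψ → (∀ v, |ψ v| ≤ Cψ) →
    let ε := hsDiameter σ N
    let bx : T3 → T3 → ℝ := fun x y => 3 / (Real.pi * r ^ 3) * max (1 - Torus.euclidDist x y / r) 0
    let bt : ℝ → ℝ := fun a => r⁻¹ * max (1 - |a| / r) 0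
    |ε / (N + 1 : ℝ) * ∫ m, bt (m.1 - t₀) * bx m.2.1 x₀ *
        (ψ (reflectVel m.2.2.1 (m.2.2.2.1, m.2.2.2.2)).1 - ψ m.2.2.2.1)
        ∂(Φ.empiricalCollisionMeasure (Set.Icc 0 τ) z)|
      ≤ ε * Cψ * (6 / (Real.pi * r ^ 4) + 3 / (Real.pi * r ^ 5) * τ * (3 / 2 + configEnergy z / (N + 1 : ℝ))) := by
  intro σ hσ hσ2 N Φ z hz τ hτ r hr t₀ x₀ ψ Cψ hCψ hψb ε bx bt
  have hε : 0 < ε := hsDiameter_pos hσ N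
  -- the space-time weight `χ(s, x) = bt(s − t₀) bx(x, x₀)` and its two constants
  set χ : ℝ × T3 → ℝ := fun p => bt (p.1 - t₀) * bx p.2 x₀ with hχ_def
  have hCχ : (0 : ℝ) ≤ 3 / (Real.pi * r ^ 4) := by positivity
  have hLχ : (0 : ℝ) ≤ 3 / (Real.pi * r ^ 5) := by positivity
  have hχb : ∀ p, |χ p| ≤ 3 / (Real.pi * r ^ 4) := fun p => by
    have ht := tent_nonneg_le hr (p.1 - t₀)
    have hc := cone_nonneg_le hr p.2 x₀
    simp only [hχ_def, bt, bx]
    rw [abs_mul, abs_of_nonneg ht.1, abs_of_nonneg hc.1]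
    calc r⁻¹ * max (1 - |p.1 - t₀| / r) 0 *
          (3 / (Real.pi * r ^ 3) * max (1 - Torus.euclidDist p.2 x₀ / r) 0)
        ≤ r⁻¹ * (3 / (Real.pi * r ^ 3)) := mul_le_mul ht.2 hc.2 hc.1 (inv_nonneg.2 hr.le)
      _ = 3 / (Real.pi * r ^ 4) := by field_simp
  have hχL : ∀ (s s' : ℝ) (x x' : T3),
      |χ (s, x) - χ (s', x')| ≤ 3 / (Real.pi * r ^ 5) * (|s - s'| + Torus.euclidDist x x') := by
    intro s s' x x'
    have ht := tent_nonneg_le hr (s' - t₀)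
    have hc := cone_nonneg_le hr x x₀
    have h1 := abs_tent_sub_tent_le hr (s - t₀) (s' - t₀)
    have h2 := abs_cone_sub_cone_le hr x x' x₀
    rw [show s - t₀ - (s' - t₀) = s - s' by ring] at h1
    simp only [hχ_def, bt, bx]
    have hsplit : r⁻¹ * max (1 - |s - t₀| / r) 0 *
          (3 / (Real.pi * r ^ 3) * max (1 - Torus.euclidDist x x₀ / r) 0) -
        r⁻¹ * max (1 - |s' - t₀| / r) 0 *
          (3 / (Real.pi * r ^ 3) * max (1 - Torus.euclidDist x' x₀ / r) 0) =
        (r⁻¹ * max (1 - |s - t₀| / r) 0 - r⁻¹ * max (1 - |s' - t₀| / r) 0) *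
            (3 / (Real.pi * r ^ 3) * max (1 - Torus.euclidDist x x₀ / r) 0) +
          r⁻¹ * max (1 - |s' - t₀| / r) 0 *
            (3 / (Real.pi * r ^ 3) * max (1 - Torus.euclidDist x x₀ / r) 0 -
              3 / (Real.pi * r ^ 3) * max (1 - Torus.euclidDist x' x₀ / r) 0) := by ring
    rw [hsplit]
    have hA : |(r⁻¹ * max (1 - |s - t₀| / r) 0 - r⁻¹ * max (1 - |s' - t₀| / r) 0) *
          (3 / (Real.pi * r ^ 3) * max (1 - Torus.euclidDist x x₀ / r) 0)| ≤
        r⁻¹ * (|s - s'| / r) * (3 / (Real.pi * r ^ 3)) := by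
      rw [abs_mul, abs_of_nonneg hc.1]
      exact mul_le_mul h1 hc.2 hc.1 (by positivity)
    have hB : |r⁻¹ * max (1 - |s' - t₀| / r) 0 *
          (3 / (Real.pi * r ^ 3) * max (1 - Torus.euclidDist x x₀ / r) 0 -
            3 / (Real.pi * r ^ 3) * max (1 - Torus.euclidDist x' x₀ / r) 0)| ≤
        r⁻¹ * (3 / (Real.pi * r ^ 3) * (Torus.euclidDist x x' / r)) := by
      rw [abs_mul, abs_of_nonneg ht.1]
      exact mul_le_mul ht.2 h2 (abs_nonneg _) (inv_nonneg.2 hr.le)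
    calc _ ≤ _ := abs_add_le _ _
      _ ≤ r⁻¹ * (|s - s'| / r) * (3 / (Real.pi * r ^ 3)) +
          r⁻¹ * (3 / (Real.pi * r ^ 3) * (Torus.euclidDist x x' / r)) := add_le_add hA hB
      _ = 3 / (Real.pi * r ^ 5) * (|s - s'| + Torus.euclidDist x x') := by
          field_simp
  -- unfold the integral to the inline collision sum and undo the recorded reflection
  have hI : ∫ m, bt (m.1 - t₀) * bx m.2.1 x₀ *
        (ψ (reflectVel m.2.2.1 (m.2.2.2.1, m.2.2.2.2)).1 - ψ m.2.2.2.1)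
        ∂(Φ.empiricalCollisionMeasure (Set.Icc 0 τ) z) =
      ∑ᶠ (s : ℝ) (_ : s ∈ collisionTimes (Torus.geometry (Fin 3)) ε (fun t => Φ.flow t z) ∩ Set.Icc 0 τ),
        ∑ i : Fin (N + 1), ∑ j : Fin (N + 1),
          (if i ≠ j ∧ ‖(Torus.geometry (Fin 3)).sepVec (Φ.flow s z i).1 (Φ.flow s z j).1‖ = ε then
            χ (s, (Φ.flow s z i).1) * (ψ (Φ.flow s z i).2 -
              ψ (reflectVel ((Torus.geometry (Fin 3)).sepVec (Φ.flow s z i).1 (Φ.flow s z j).1)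
                ((Φ.flow s z i).2, (Φ.flow s z j).2)).1)
          else 0) := by
    refine (Φ.integral_empiricalCollisionMeasure_eq_finsum_ite hz (Subset.refl (Set.Icc 0 τ)) _).trans
      (finsum_mem_congr rfl fun s _ => Finset.sum_congr rfl fun i _ => Finset.sum_congr rfl fun j _ => ?_)
    split_ifs with hij
    · dsimp only
      rw [reflectVel_unit_pre_fst hε]
    · rfl
  have key := collisionInvariance_of_trajectory hε
    (Torus.isHardSphereRegular_geometry ((hsDiameter_le hσ.le N).trans_lt hσ2))
    euclidDist_translate_self_le (Φ.isTrajectory z hz) (Φ.flow_zero z hz) hτ hCχ hLχ hχb hχL hCψ hψb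
  rw [hI]
  refine key.trans_eq ?_
  ring

end Summit.AtomisticToContinuum.HydrodynamicLimit.Theorems.ChaosClosesEulerWindowedInvariance

end
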